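import Mathlib
import HarnessLib

/-!
# Crux `MobiusLadder.LiouvilleOrthogonalTC0` (stmt-QuantumAdvantage-1393), line `Sketch`, skeleton v6:
# stub `stub_kaneClaim` — Kane's one-step sensitivity inequality

D. M. Kane, *The average sensitivity of an intersection of half spaces* (STOC 2014,
arXiv:1309.2987), proof of Proposition 3: the Claim and the three displayed lines after it, in
counting form on the cube `{0,1}^m`.

Let `F, f : {0,1}^m → {0,1}` with `f` unate of orientation `o` (moving coordinate `j` from `¬o_j`
to `o_j` can only switch `f` on), `G = F ∨ f`, `S = ¬F ∧ f`, and `x_j(σ) = +1` if `σ_j = o_j`,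
`-1` otherwise. Then
`#{(σ,j) : G σ ≠ G σ^{⊕j}} - #{(σ,j) : F σ ≠ F σ^{⊕j}} ≤ 2 Σ_σ S(σ) Σ_j x_j(σ)`.

Proof: the pointwise inequality
`|G σ - G σ^j| - |F σ - F σ^j| ≤ x_j(σ)((G σ - G σ^j) - (F σ - F σ^j))`
(a finite Boolean case analysis once the two consequences of unateness at `(σ, j)` are isolated),
then `G - F = S` and the symmetrisation `Σ_σ x_j(σ) S(σ^{⊕j}) = -Σ_σ x_j(σ) S(σ)` under the
bit-flip involution `σ ↦ σ^{⊕j} = Function.update σ j (!σ j)` (which negates `x_j`). Pure cube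
combinatorics over Mathlib; Booleans are embedded in `ℝ` as `if b = true then 1 else 0`.
-/

set_option linter.dupNamespace false -- D-0017: single-problem summit ⇒ `QuantumAdvantage.QuantumAdvantage` by design

noncomputable section

namespace Summit.QuantumAdvantage.QuantumAdvantage.Theorems.LiouvilleOrthogonalTC0

open Finset

namespace StubKaneClaim

/-- Flipping the same bit twice is the identity. -/
theorem flip_flip {m : ℕ} (j : Fin m) (σ : Fin m → Bool) :
    Function.update (Function.update σ j (!σ j)) j (!Function.update σ j (!σ j) j) = σ := by
  rw [Function.update_idem, Function.update_self, Bool.not_not, Function.update_eq_self]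

/-- The bit flip at `j` is an involution of the cube. -/
theorem flip_involutive {m : ℕ} (j : Fin m) :
    Function.Involutive (fun σ : Fin m → Bool => Function.update σ j (!σ j)) :=
  fun σ => flip_flip j σ

/-- Flipping bit `j` negates the signed coordinate `x_j`. -/
theorem sign_flip {m : ℕ} (o : Fin m → Bool) (j : Fin m) (σ : Fin m → Bool) :
    (if Function.update σ j (!σ j) j = o j then (1 : ℝ) else -1)
      = -(if σ j = o j then (1 : ℝ) else -1) := by
  rw [Function.update_self]
  cases σ j <;> cases o j <;> norm_num

/-- `G - F = S`: the indicator of `F ∨ f` minus that of `F` is the indicator of `¬F ∧ f`. -/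
theorem ind_or_sub (a b : Bool) :
    (if (a || b) = true then (1 : ℝ) else 0) - (if a = true then (1 : ℝ) else 0)
      = (if (!a && b) = true then (1 : ℝ) else 0) := by
  cases a <;> cases b <;> simp

/-- The pointwise Boolean inequality behind Kane's Claim: with `a = F σ`, `a' = F σ^j`, `b = f σ`,
`b' = f σ^j`, `e = [σ_j = o_j]`, and the two consequences `h₁, h₂` of unateness,
`|G σ - G σ^j| - |F σ - F σ^j| ≤ x_j(σ)((G σ - G σ^j) - (F σ - F σ^j))`. -/
theorem pointwise_bool (a a' b b' : Bool) (e : Prop) [Decidable e]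
    (h₁ : e → b' = true → b = true) (h₂ : ¬e → b = true → b' = true) :
    (if (a || b) ≠ (a' || b') then (1 : ℝ) else 0) - (if a ≠ a' then (1 : ℝ) else 0)
      ≤ (if e then (1 : ℝ) else -1) *
          (((if (a || b) = true then (1 : ℝ) else 0) - (if (a' || b') = true then (1 : ℝ) else 0))
            - ((if a = true then (1 : ℝ) else 0) - (if a' = true then (1 : ℝ) else 0))) := by
  by_cases he : e
  · have h := h₁ he
    cases a <;> cases a' <;> cases b <;> cases b' <;> simp_all
  · have h := h₂ he
    cases a <;> cases a' <;> cases b <;> cases b' <;> simp_all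

/-- The two consequences of unateness at a point `σ` and a coordinate `j`:
if `σ_j = o_j` then `f σ^j → f σ`, and if `σ_j ≠ o_j` then `f σ → f σ^j`. -/
theorem unate_at {m : ℕ} (f : (Fin m → Bool) → Bool) (o : Fin m → Bool)
    (hf : ∀ (σ : Fin m → Bool) (j : Fin m),
      f (Function.update σ j (!o j)) = true → f (Function.update σ j (o j)) = true)
    (σ : Fin m → Bool) (j : Fin m) :
    (σ j = o j → f (Function.update σ j (!σ j)) = true → f σ = true) ∧
      (¬(σ j = o j) → f σ = true → f (Function.update σ j (!σ j)) = true) := by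
  constructor
  · intro h hflip
    have key := hf σ j
    rw [← h, Function.update_eq_self] at key
    exact key hflip
  · intro h hσ
    have h' : σ j = !o j := by
      revert h; cases σ j <;> cases o j <;> simp
    have key := hf σ j
    rw [← h', Function.update_eq_self] at key
    rw [h', Bool.not_not]
    exact key hσ

/-- The pointwise inequality at `(σ, j)` for `G = F ∨ f`, `f` unate of orientation `o`. -/
theorem pointwise {m : ℕ} (F f : (Fin m → Bool) → Bool) (o : Fin m → Bool)
    (hf : ∀ (σ : Fin m → Bool) (j : Fin m),
      f (Function.update σ j (!o j)) = true → f (Function.update σ j (o j)) = true)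
    (σ : Fin m → Bool) (j : Fin m) :
    (if (F σ || f σ) ≠ (F (Function.update σ j (!σ j)) || f (Function.update σ j (!σ j)))
          then (1 : ℝ) else 0)
        - (if F σ ≠ F (Function.update σ j (!σ j)) then (1 : ℝ) else 0)
      ≤ (if σ j = o j then (1 : ℝ) else -1) *
          (((if (F σ || f σ) = true then (1 : ℝ) else 0)
              - (if (F (Function.update σ j (!σ j)) || f (Function.update σ j (!σ j))) = true
                  then (1 : ℝ) else 0))
            - ((if F σ = true then (1 : ℝ) else 0)
              - (if F (Function.update σ j (!σ j)) = true then (1 : ℝ) else 0))) := by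
  obtain ⟨h₁, h₂⟩ := unate_at f o hf σ j
  exact pointwise_bool (F σ) (F (Function.update σ j (!σ j))) (f σ)
    (f (Function.update σ j (!σ j))) (σ j = o j) h₁ h₂

/-- Symmetrisation under the bit flip at `j`: `Σ_σ x_j(σ) S(σ^{⊕j}) = -Σ_σ x_j(σ) S(σ)`. -/
theorem sum_sign_flip {m : ℕ} (o : Fin m → Bool) (j : Fin m) (S : (Fin m → Bool) → ℝ) :
    ∑ σ : Fin m → Bool, (if σ j = o j then (1 : ℝ) else -1) * S (Function.update σ j (!σ j))
      = -∑ σ : Fin m → Bool, (if σ j = o j then (1 : ℝ) else -1) * S σ := by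
  have h := (flip_involutive j).bijective.sum_comp
    (fun σ => (if σ j = o j then (1 : ℝ) else -1) * S (Function.update σ j (!σ j)))
  simp only [flip_flip, sign_flip] at h
  rw [← h, ← Finset.sum_neg_distrib]
  exact Finset.sum_congr rfl fun σ _ => neg_mul _ _

/-- The symmetrised double sum: `Σ_σ Σ_j x_j(σ)(S σ - S σ^{⊕j}) = 2 Σ_σ S(σ) Σ_j x_j(σ)`. -/
theorem double_sum_symm {m : ℕ} (o : Fin m → Bool) (S : (Fin m → Bool) → ℝ) :
    ∑ σ : Fin m → Bool, ∑ j : Fin m,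
        (if σ j = o j then (1 : ℝ) else -1) * (S σ - S (Function.update σ j (!σ j)))
      = 2 * ∑ σ : Fin m → Bool, S σ * ∑ j : Fin m, (if σ j = o j then (1 : ℝ) else -1) := by
  have h1 : ∑ σ : Fin m → Bool, ∑ j : Fin m,
        (if σ j = o j then (1 : ℝ) else -1) * S (Function.update σ j (!σ j))
      = -∑ σ : Fin m → Bool, ∑ j : Fin m, (if σ j = o j then (1 : ℝ) else -1) * S σ :=
    calc ∑ σ : Fin m → Bool, ∑ j : Fin m,
          (if σ j = o j then (1 : ℝ) else -1) * S (Function.update σ j (!σ j))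
        = ∑ j : Fin m, ∑ σ : Fin m → Bool,
            (if σ j = o j then (1 : ℝ) else -1) * S (Function.update σ j (!σ j)) :=
          Finset.sum_comm
      _ = ∑ j : Fin m, -∑ σ : Fin m → Bool, (if σ j = o j then (1 : ℝ) else -1) * S σ :=
          Finset.sum_congr rfl fun j _ => sum_sign_flip o j S
      _ = -∑ j : Fin m, ∑ σ : Fin m → Bool, (if σ j = o j then (1 : ℝ) else -1) * S σ :=
          Finset.sum_neg_distrib _
      _ = -∑ σ : Fin m → Bool, ∑ j : Fin m, (if σ j = o j then (1 : ℝ) else -1) * S σ := by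
          rw [Finset.sum_comm]
  have h2 : ∀ σ : Fin m → Bool, ∑ j : Fin m, (if σ j = o j then (1 : ℝ) else -1) * S σ
      = S σ * ∑ j : Fin m, (if σ j = o j then (1 : ℝ) else -1) := by
    intro σ
    rw [Finset.mul_sum]
    exact Finset.sum_congr rfl fun j _ => mul_comm _ _
  simp only [mul_sub, Finset.sum_sub_distrib]
  rw [h1, sub_neg_eq_add, ← two_mul]
  congr 1
  exact Finset.sum_congr rfl fun σ _ => h2 σ

end StubKaneClaim

open StubKaneClaim in
/-- **Stub `stub_kaneClaim` (line `Sketch`, v6) — Kane's one-step inequality** (Kane 2014, proof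
of Prop. 3, the Claim and the three displayed lines after it, in counting form on `{0,1}^m`). Let
`F, f : {0,1}^m → {0,1}` with `f` UNATE of orientation `o` (moving coordinate `j` from `¬o_j` to
`o_j` can only switch `f` on), `G = F ∨ f`, `S = ¬F ∧ f`, and `x_j(σ) = +1` if `σ_j = o_j`, `-1`
otherwise. Then
`#{(σ,j) : G(σ) ≠ G(σ^{⊕j})} - #{(σ,j) : F(σ) ≠ F(σ^{⊕j})} ≤ 2 Σ_σ S(σ) Σ_j x_j(σ)`. -/
theorem stub_kaneClaim {m : ℕ} (F f : (Fin m → Bool) → Bool) (o : Fin m → Bool)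
    (hf : ∀ (σ : Fin m → Bool) (j : Fin m),
      f (Function.update σ j (!o j)) = true → f (Function.update σ j (o j)) = true) :
    (∑ σ : Fin m → Bool, ((univ.filter fun j : Fin m =>
        (F σ || f σ) ≠ (F (Function.update σ j (!σ j)) || f (Function.update σ j (!σ j)))).card : ℝ))
      - (∑ σ : Fin m → Bool, ((univ.filter fun j : Fin m =>
          F σ ≠ F (Function.update σ j (!σ j))).card : ℝ))
      ≤ 2 * ∑ σ : Fin m → Bool, (if (!F σ && f σ) = true then
          ∑ j : Fin m, (if σ j = o j then (1 : ℝ) else -1) else 0) := by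
  -- (a) cards of filters as sums of indicators, and the difference as one double sum
  simp only [Finset.natCast_card_filter]
  rw [← Finset.sum_sub_distrib]
  simp only [← Finset.sum_sub_distrib]
  -- (b)+(d) the pointwise inequality, summed; (c) `G - F = S` and the symmetrisation
  calc ∑ σ : Fin m → Bool, ∑ j : Fin m,
        ((if (F σ || f σ) ≠ (F (Function.update σ j (!σ j)) || f (Function.update σ j (!σ j)))
            then (1 : ℝ) else 0)
          - (if F σ ≠ F (Function.update σ j (!σ j)) then (1 : ℝ) else 0))
      ≤ ∑ σ : Fin m → Bool, ∑ j : Fin m, (if σ j = o j then (1 : ℝ) else -1) *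
          (((if (F σ || f σ) = true then (1 : ℝ) else 0)
              - (if (F (Function.update σ j (!σ j)) || f (Function.update σ j (!σ j))) = true
                  then (1 : ℝ) else 0))
            - ((if F σ = true then (1 : ℝ) else 0)
              - (if F (Function.update σ j (!σ j)) = true then (1 : ℝ) else 0))) :=
        Finset.sum_le_sum fun σ _ => Finset.sum_le_sum fun j _ => pointwise F f o hf σ j
    _ = ∑ σ : Fin m → Bool, ∑ j : Fin m, (if σ j = o j then (1 : ℝ) else -1) *
          (((if (F σ || f σ) = true then (1 : ℝ) else 0) - (if F σ = true then (1 : ℝ) else 0))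
            - ((if (F (Function.update σ j (!σ j)) || f (Function.update σ j (!σ j))) = true
                  then (1 : ℝ) else 0)
              - (if F (Function.update σ j (!σ j)) = true then (1 : ℝ) else 0))) := by
        refine Finset.sum_congr rfl fun σ _ => Finset.sum_congr rfl fun j _ => ?_
        ring
    _ = 2 * ∑ σ : Fin m → Bool,
          ((if (F σ || f σ) = true then (1 : ℝ) else 0) - (if F σ = true then (1 : ℝ) else 0)) *
            ∑ j : Fin m, (if σ j = o j then (1 : ℝ) else -1) :=
        double_sum_symm o fun σ =>
          (if (F σ || f σ) = true then (1 : ℝ) else 0) - (if F σ = true then (1 : ℝ) else 0)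
    _ = 2 * ∑ σ : Fin m → Bool, (if (!F σ && f σ) = true then
          ∑ j : Fin m, (if σ j = o j then (1 : ℝ) else -1) else 0) := by
        congr 1
        refine Finset.sum_congr rfl fun σ _ => ?_
        rw [ind_or_sub]
        split_ifs <;> simp

end Summit.QuantumAdvantage.QuantumAdvantage.Theorems.LiouvilleOrthogonalTC0

end
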